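import Literature.AlgebraicGeometry.Resolution.AlterationsBoundaryDivisor
import Literature.AlgebraicGeometry.Resolution.HypersurfaceTransform
import Literature.AlgebraicGeometry.Resolution.BlowupChartMembership
import Literature.AlgebraicGeometry.Resolution.StalkIdealLemmas
import Literature.AlgebraicGeometry.Resolution.SmoothGenericFibreSpread
import Literature.AlgebraicGeometry.Resolution.BlowupsRelativeCartier
import Literature.AlgebraicGeometry.Limits.GenericFibreSpread
import Mathlib.AlgebraicGeometry.Noetherian
import HarnessLib

/-!
# Effective Cartier divisors through their stalks; the Cartier locus spreads from the generic fibre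

Topic: `Literature/AlgebraicGeometry/Resolution`. Stalkwise handling of the effective Cartier
condition `IsEffectiveCartier` of `Blowups.lean` (Görtz–Wedhorn I (13.19), Stacks 01WR–01WS) on
locally Noetherian schemes, and its behaviour in a family over a domain `A` with fraction field
`K` (the relative-Cartier input of the spreading-out argument for `SpreadsShapedFromGenericPoint`,
`CanonicalResolutionSpread.lean`). Everything is PROVED:

* `exists_basicOpen_map_mem_nonZeroDivisors` — a section whose germ at `x` is a
  non-zero-divisor of `𝒪_{X,x}` is a non-zero-divisor on a basic open neighbourhood of `x` (its
  annihilator is finitely generated and dies in the stalk);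
* `isEffectiveCartier_of_forall_mem_nonZeroDivisors` — **Stacks 01WS, locally Noetherian form:
  an ideal sheaf whose stalk at each point of its support is generated by a non-zero-divisor is
  an effective Cartier divisor** (the tree's `isEffectiveCartier_of_stalkIdeal_eq_span_singleton`
  assumed `X` integral);
* `cartierLocus I = {x | I_x = (g), g a non-zero-divisor}` — **the Cartier locus**: open
  (`isOpen_cartierLocus`), all of `X` iff `I` is an effective Cartier divisor
  (`isEffectiveCartier_iff_forall_mem_cartierLocus`), detected through any morphism inducing
  isomorphisms of local rings (`mem_cartierLocus_comap_iff`), so that `I` is an effective Cartier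
  divisor on every open inside the locus (`isEffectiveCartier_comap_ι_of_forall_mem_cartierLocus`);
* `exists_forall_mem_cartierLocus_of_generic` — **the effective Cartier property spreads out
  from the generic fibre**: for `q : X → Spec A` of finite presentation with `X` Noetherian,
  if `I · 𝒪_{X_K}` is an effective Cartier divisor on the generic fibre `X_K = X ×_A Spec K`
  then every point over some `D(b)`, `b ≠ 0`, lies in the Cartier locus (Chevalley, as for the
  smooth locus in `SmoothGenericFibreSpread.lean`: the projection `X_K → X` induces
  isomorphisms of local rings, and the complement of the open Cartier locus has constructible
  image missing the generic point); `exists_isEffectiveCartier_comap_ι_of_generic` — hence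
  `I|_{q⁻¹ D(b)}` is an effective Cartier divisor.

## Sources

* The Stacks Project, Tags 01WR–01WS (effective Cartier divisors), 054K (Chevalley).
  [StacksProject]
* A. Grothendieck, J. Dieudonné, EGA IV₃ (1966), §8–§9 (spreading out from the generic fibre);
  EGA IV₄ (1967), (21.15.9) (relative effective Cartier divisors). [folklore]
* U. Görtz, T. Wedhorn, *Algebraic Geometry I*, 2nd ed. (2020), (13.19), Remark 11.27.
  [GortzWedhorn2020]
-/

noncomputable section

open CategoryTheory CategoryTheory.Limits AlgebraicGeometry TopologicalSpace IsLocalRing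
  PrimeSpectrum

namespace Literature.AlgebraicGeometry.Resolution

universe u

variable {X : Scheme.{u}}

open Scheme.IdealSheafData

/-! ## Non-zero-divisor germs spread to a neighbourhood -/

/-- **A section whose germ at `x` is a non-zero-divisor of `𝒪_{X,x}` is a non-zero-divisor on a
basic open neighbourhood of `x`** (`X` locally Noetherian): the annihilator of the section is
finitely generated and dies in `𝒪_{X,x}`, hence is killed by some `t` with `t(x) ≠ 0`.
[folklore] -/
theorem exists_basicOpen_map_mem_nonZeroDivisors [IsLocallyNoetherian X] (U : X.affineOpens)
    {x : X} (hxU : x ∈ (U : X.Opens)) (i : Γ(X, U))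
    (hi : (X.presheaf.germ U x hxU).hom i ∈ nonZeroDivisors (X.presheaf.stalk x)) :
    ∃ t : Γ(X, U), x ∈ X.basicOpen t ∧
      X.presheaf.map (homOfLE (X.basicOpen_le t)).op i ∈ nonZeroDivisors Γ(X, X.basicOpen t) := by
  classical
  haveI : IsNoetherianRing Γ(X, U) := IsLocallyNoetherian.component_noetherian U
  letI : Algebra Γ(X, U) (X.presheaf.stalk x) := (X.presheaf.germ U x hxU).hom.toAlgebra
  haveI hloc : IsLocalization.AtPrime (X.presheaf.stalk x) (U.2.primeIdealOf ⟨x, hxU⟩).asIdeal :=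
    U.2.isLocalization_stalk ⟨x, hxU⟩
  have halg : ∀ a : Γ(X, U), algebraMap Γ(X, U) (X.presheaf.stalk x) a =
      (X.presheaf.germ U x hxU).hom a := fun _ => rfl
  -- the annihilator `N` of `i`, finitely generated
  set N : Submodule Γ(X, U) Γ(X, U) := LinearMap.ker (LinearMap.mul Γ(X, U) Γ(X, U) i) with hN
  have hNmem : ∀ a, a ∈ N ↔ i * a = 0 := fun a => by
    rw [hN, LinearMap.mem_ker, LinearMap.mul_apply']
  obtain ⟨G, hG⟩ : N.FG := IsNoetherian.noetherian N
  -- each generator dies in `𝒪_{X,x}`, hence is killed by an element not vanishing at `x`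
  have hkill : ∀ j ∈ G, ∃ t : (U.2.primeIdealOf ⟨x, hxU⟩).asIdeal.primeCompl,
      (t : Γ(X, U)) * j = 0 := by
    intro j hj
    have hjN : j ∈ N := hG ▸ Submodule.subset_span hj
    have h0 : algebraMap Γ(X, U) (X.presheaf.stalk x) j = 0 := by
      have h1 : algebraMap Γ(X, U) (X.presheaf.stalk x) j *
          algebraMap Γ(X, U) (X.presheaf.stalk x) i = 0 := by
        rw [← map_mul, mul_comm, (hNmem j).mp hjN, map_zero]
      rw [halg] at h1
      exact (mem_nonZeroDivisors_iff_right.mp hi) _ h1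
    exact (IsLocalization.map_eq_zero_iff (U.2.primeIdealOf ⟨x, hxU⟩).asIdeal.primeCompl
      (X.presheaf.stalk x) j).mp h0
  choose! t ht using hkill
  set T : Γ(X, U) := ∏ j ∈ G, (t j : Γ(X, U)) with hT
  have hTmem : T ∈ (U.2.primeIdealOf ⟨x, hxU⟩).asIdeal.primeCompl :=
    prod_mem fun j _ => (t j).2
  -- `T` kills the whole annihilator
  have hTN : ∀ a ∈ N, T * a = 0 := by
    intro a ha
    rw [← hG] at ha
    refine Submodule.span_induction (p := fun a _ => T * a = 0) ?_ ?_ ?_ ?_ ha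
    · intro j hj
      rw [hT, ← Finset.prod_erase_mul G (fun j => (t j : Γ(X, U))) hj, mul_assoc, ht j hj,
        mul_zero]
    · exact mul_zero T
    · intro a b _ _ ha hb
      rw [mul_add, ha, hb, add_zero]
    · intro r a _ ha
      rw [smul_eq_mul, mul_left_comm, ha, mul_zero]
  refine ⟨T, ?_, ?_⟩
  · rw [X.mem_basicOpen T x hxU]
    have hu := IsLocalization.map_units (X.presheaf.stalk x) (⟨T, hTmem⟩ :
      (U.2.primeIdealOf ⟨x, hxU⟩).asIdeal.primeCompl)
    exact hu
  · haveI := U.2.isLocalization_basicOpen T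
    rw [mem_nonZeroDivisors_iff_right]
    intro b hb
    obtain ⟨⟨a, s⟩, rfl⟩ := IsLocalization.mk'_surjective (Submonoid.powers T) b
    have hb' : algebraMap Γ(X, U) Γ(X, X.basicOpen T) (a * i) = 0 := by
      have e1 : algebraMap Γ(X, U) Γ(X, X.basicOpen T) (a * i) =
          algebraMap Γ(X, U) Γ(X, X.basicOpen T) (s : Γ(X, U)) *
            (IsLocalization.mk' Γ(X, X.basicOpen T) a s *
              X.presheaf.map (homOfLE (X.basicOpen_le T)).op i) := by
        rw [← mul_assoc, IsLocalization.mk'_spec' Γ(X, X.basicOpen T) a s, map_mul]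
        rfl
      rw [e1, hb, mul_zero]
    obtain ⟨⟨m, hm⟩, hma⟩ := (IsLocalization.map_eq_zero_iff (Submonoid.powers T)
      Γ(X, X.basicOpen T) _).mp hb'
    obtain ⟨k, rfl⟩ := (Submonoid.mem_powers_iff _ _).mp hm
    -- `T^k a` annihilates `i`, hence is killed by `T`
    have hN' : T ^ k * a ∈ N := (hNmem _).mpr (by
      have h2 : T ^ k * (a * i) = 0 := hma
      rw [← h2]
      ring)
    have hkill' : T ^ (k + 1) * a = 0 := by
      rw [pow_succ', mul_assoc]
      exact hTN _ hN'
    exact (IsLocalization.mk'_eq_zero_iff _ _).mpr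
      ⟨⟨T ^ (k + 1), (Submonoid.mem_powers_iff _ _).mpr ⟨k + 1, rfl⟩⟩, hkill'⟩

/-! ## The Cartier locus -/

/-- **The Cartier locus of an ideal sheaf**: the points at which the stalk `I_x` is generated by
a non-zero-divisor of `𝒪_{X,x}` (all points off `V(I)`, where `I_x = (1)`).
[cite: StacksProject, Tag 01WS] -/
def cartierLocus (I : X.IdealSheafData) : Set X :=
  {x | ∃ g ∈ nonZeroDivisors (X.presheaf.stalk x), stalkIdeal I x = Ideal.span {g}}

/-- Membership in the Cartier locus. [folklore] -/
theorem mem_cartierLocus_iff (I : X.IdealSheafData) (x : X) :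
    x ∈ cartierLocus I ↔
      ∃ g ∈ nonZeroDivisors (X.presheaf.stalk x), stalkIdeal I x = Ideal.span {g} :=
  Iff.rfl

/-- Points off the support lie in the Cartier locus. [folklore] -/
theorem mem_cartierLocus_of_not_mem_support (I : X.IdealSheafData) {x : X} (hx : x ∉ I.support) :
    x ∈ cartierLocus I :=
  ⟨1, one_mem _, by rw [stalkIdeal_eq_top_of_not_mem_support hx, Ideal.span_singleton_one]⟩

/-- The stalks of an effective Cartier divisor: every point lies in the Cartier locus
(`IsEffectiveCartier.exists_stalkIdeal_eq_span`). [cite: StacksProject, Tag 01WS] -/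
theorem IsEffectiveCartier.mem_cartierLocus {I : X.IdealSheafData} (h : IsEffectiveCartier I)
    (x : X) : x ∈ cartierLocus I :=
  h.exists_stalkIdeal_eq_span x

/-- **A Cartier chart around a point of the Cartier locus** (`X` locally Noetherian): an affine
open `V ∋ x` and a non-zero-divisor `i ∈ Γ(X, V)` with `I(V) = (i)` (Nakayama picks a section
whose germ generates `I_x`, `exists_mem_span_singleton_eq_of_span_eq`; it generates `I` near
`x`, `exists_ideal_eq_span_singleton_of_stalkIdeal_eq`, and is a non-zero-divisor on a smaller
basic open, `exists_basicOpen_map_mem_nonZeroDivisors`). [cite: StacksProject, Tag 01WS] -/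
theorem exists_chart_of_mem_cartierLocus [IsLocallyNoetherian X] {I : X.IdealSheafData} {x : X}
    (hx : x ∈ cartierLocus I) :
    ∃ V : X.affineOpens, x ∈ (V : X.Opens) ∧
      ∃ i : Γ(X, V), i ∈ nonZeroDivisors Γ(X, V) ∧ I.ideal V = Ideal.span {i} := by
  obtain ⟨g, hg, hIg⟩ := hx
  obtain ⟨U, hU, hxU, -⟩ :=
    exists_isAffineOpen_mem_and_subset (X := X) (x := x) (U := ⊤) (Opens.mem_top x)
  have hg0 : g ≠ 0 := nonZeroDivisors.ne_zero hg
  have hspan : Ideal.span ((X.presheaf.germ U x hxU).hom '' (I.ideal ⟨U, hU⟩)) =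
      Ideal.span {g} := by
    rw [← hIg, stalkIdeal_eq_map_germ I ⟨U, hU⟩ hxU, Ideal.map]
  obtain ⟨_, ⟨i, hi, rfl⟩, hgen⟩ := exists_mem_span_singleton_eq_of_span_eq hg0 hspan
  have hIi : stalkIdeal I x = Ideal.span {(X.presheaf.germ U x hxU).hom i} := by rw [hgen, hIg]
  have hinzd : (X.presheaf.germ U x hxU).hom i ∈ nonZeroDivisors (X.presheaf.stalk x) :=
    mem_nonZeroDivisors_of_span_singleton_eq hgen hg
  obtain ⟨V, hVU, hxV, hIV⟩ :=
    exists_ideal_eq_span_singleton_of_stalkIdeal_eq I ⟨U, hU⟩ hxU i hi hIi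
  set i' : Γ(X, V) := X.presheaf.map (homOfLE hVU).op i with hi'def
  have hgerm' : (X.presheaf.germ V x hxV).hom i' = (X.presheaf.germ U x hxU).hom i := by
    rw [hi'def]
    exact TopCat.Presheaf.germ_res_apply X.presheaf _ x hxV i
  have hinzd' : (X.presheaf.germ V x hxV).hom i' ∈ nonZeroDivisors (X.presheaf.stalk x) := by
    rw [hgerm']
    exact hinzd
  obtain ⟨t, hxt, ht⟩ := exists_basicOpen_map_mem_nonZeroDivisors V hxV i' hinzd'
  refine ⟨X.affineBasicOpen t, hxt, _, ht, ?_⟩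
  rw [← I.map_ideal_basicOpen, hIV, Ideal.map_span, Set.image_singleton]
  rfl

/-- All points of an affine open carrying a Cartier chart lie in the Cartier locus (the germs
of a non-zero-divisor of the Noetherian ring `Γ(X, V)` are non-zero-divisors of the stalks, its
localizations). [folklore] -/
theorem mem_cartierLocus_of_chart {I : X.IdealSheafData} (V : X.affineOpens) {i : Γ(X, V)}
    (hi : i ∈ nonZeroDivisors Γ(X, V)) (hIV : I.ideal V = Ideal.span {i}) {y : X}
    (hy : y ∈ (V : X.Opens)) : y ∈ cartierLocus I := by
  letI : Algebra Γ(X, V) (X.presheaf.stalk y) := (X.presheaf.germ V y hy).hom.toAlgebra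
  haveI : IsLocalization.AtPrime (X.presheaf.stalk y) (V.2.primeIdealOf ⟨y, hy⟩).asIdeal :=
    V.2.isLocalization_stalk ⟨y, hy⟩
  refine ⟨(X.presheaf.germ V y hy).hom i, ?_, ?_⟩
  · exact map_mem_nonZeroDivisors_of_isLocalization (V.2.primeIdealOf ⟨y, hy⟩).asIdeal.primeCompl
      (X.presheaf.stalk y) hi
  · rw [stalkIdeal_eq_map_germ I V hy, hIV, Ideal.map_span, Set.image_singleton]

/-- **The Cartier locus is open** (`X` locally Noetherian). [cite: StacksProject, Tag 01WS] -/
theorem isOpen_cartierLocus [IsLocallyNoetherian X] (I : X.IdealSheafData) :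
    IsOpen (cartierLocus I) := by
  refine isOpen_iff_forall_mem_open.mpr fun x hx => ?_
  obtain ⟨V, hxV, i, hi, hIV⟩ := exists_chart_of_mem_cartierLocus hx
  exact ⟨(V : X.Opens), fun y hy => mem_cartierLocus_of_chart V hi hIV hy, V.1.isOpen, hxV⟩

/-- **Stacks 01WS, locally Noetherian form: an ideal sheaf whose stalk at every point of its
support is generated by a non-zero-divisor is an effective Cartier divisor.**
[cite: StacksProject, Tag 01WS] -/
theorem isEffectiveCartier_of_forall_mem_nonZeroDivisors [IsLocallyNoetherian X]
    {I : X.IdealSheafData}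
    (h : ∀ x ∈ I.support, ∃ g ∈ nonZeroDivisors (X.presheaf.stalk x),
      stalkIdeal I x = Ideal.span {g}) :
    IsEffectiveCartier I := by
  intro x
  have hx : x ∈ cartierLocus I := by
    by_cases hxs : x ∈ I.support
    · exact h x hxs
    · exact mem_cartierLocus_of_not_mem_support I hxs
  obtain ⟨V, hxV, i, hi, hIV⟩ := exists_chart_of_mem_cartierLocus hx
  exact ⟨V, hxV, i, hi, hIV⟩

/-- **`I` is an effective Cartier divisor iff every point lies in its Cartier locus** (`X`
locally Noetherian). [cite: StacksProject, Tag 01WS] -/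
theorem isEffectiveCartier_iff_forall_mem_cartierLocus [IsLocallyNoetherian X]
    (I : X.IdealSheafData) : IsEffectiveCartier I ↔ ∀ x : X, x ∈ cartierLocus I :=
  ⟨fun h x => h.mem_cartierLocus x,
    fun h => isEffectiveCartier_of_forall_mem_nonZeroDivisors fun x _ => h x⟩

/-- **The Cartier locus is detected through isomorphisms of local rings**: if `f : X' → X`
induces an isomorphism `𝒪_{X, f x'} ≅ 𝒪_{X', x'}` (an open immersion; the inclusion of the
generic fibre of a family), then `x'` lies in the Cartier locus of `f^*I` iff `f x'` lies in the
Cartier locus of `I`. [folklore] -/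
theorem mem_cartierLocus_comap_iff {X' : Scheme.{u}} (f : X' ⟶ X) (x' : X')
    [IsIso (f.stalkMap x')] (I : X.IdealSheafData) :
    x' ∈ cartierLocus (I.comap f) ↔ f x' ∈ cartierLocus I := by
  let e : X.presheaf.stalk (f x') ≃+* X'.presheaf.stalk x' :=
    (asIso (f.stalkMap x')).commRingCatIsoToRingEquiv
  have he : ∀ a, e a = (f.stalkMap x').hom a := fun _ => rfl
  have hst : stalkIdeal (I.comap f) x' = (stalkIdeal I (f x')).map e.toRingHom := by
    rw [stalkIdeal_comap_eq_map_stalkMap]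
    rfl
  constructor
  · rintro ⟨g', hg', hgen⟩
    refine ⟨e.symm g', ?_, ?_⟩
    · refine mem_nonZeroDivisors_of_map_ringEquiv e ?_
      rw [RingEquiv.apply_symm_apply]
      exact hg'
    · have h1 : ((stalkIdeal I (f x')).map e.toRingHom).map e.symm.toRingHom =
          (Ideal.span {g'}).map e.symm.toRingHom := by rw [← hst, hgen]
      rw [Ideal.map_map, Ideal.map_span, Set.image_singleton] at h1
      have h2 : e.symm.toRingHom.comp e.toRingHom = RingHom.id _ :=
        RingHom.ext fun a => e.symm_apply_apply a
      rw [h2, Ideal.map_id] at h1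
      exact h1
  · rintro ⟨g, hg, hgen⟩
    refine ⟨e g, ?_, ?_⟩
    · refine mem_nonZeroDivisors_of_map_ringEquiv e.symm ?_
      rw [RingEquiv.symm_apply_apply]
      exact hg
    · rw [hst, hgen, Ideal.map_span, Set.image_singleton]
      rfl

/-- **An ideal sheaf is an effective Cartier divisor on every open inside its Cartier locus.**
[cite: StacksProject, Tag 01WS] -/
theorem isEffectiveCartier_comap_ι_of_forall_mem_cartierLocus [IsLocallyNoetherian X]
    {I : X.IdealSheafData} {U : X.Opens} (h : ∀ x ∈ U, x ∈ cartierLocus I) :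
    IsEffectiveCartier (I.comap U.ι) :=
  (isEffectiveCartier_iff_forall_mem_cartierLocus _).mpr fun x =>
    (mem_cartierLocus_comap_iff U.ι x I).mpr (h _ x.2)

/-! ## The Cartier locus spreads out from the generic fibre -/

section Generic

variable {A : Type u} [CommRing A] [IsDomain A] (K : Type u) [Field K] [Algebra A K]
  [IsFractionRing A K] (q : X ⟶ Spec (CommRingCat.of A)) [LocallyOfFinitePresentation q]

/-- **The effective Cartier property spreads out from the generic fibre.** Let `X` be
Noetherian, `q : X → Spec A` of finite presentation (`A` a domain with fraction field `K`) and
`I` an ideal sheaf on `X` whose extension `I · 𝒪_{X_K}` to the generic fibre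
`X_K = X ×_{Spec A} Spec K` is an effective Cartier divisor. Then there is `b ≠ 0` in `A` such
that every point of `X` over `D(b)` lies in the Cartier locus of `I` (the projection `X_K → X` is
a flat preimmersion, so it induces isomorphisms of local rings and the generic fibre lies in the
open Cartier locus; Chevalley for the complement). [folklore] -/
theorem exists_forall_mem_cartierLocus_of_generic [QuasiCompact q] [IsNoetherian X]
    (I : X.IdealSheafData) (hK : IsEffectiveCartier (I.comap (pullback.fst q (specOfAlgebra A K)))) :
    ∃ b : A, b ≠ 0 ∧ ∀ x : X, q x ∈ (basicOpen b : Set (PrimeSpectrum A)) → x ∈ cartierLocus I := by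
  haveI := flat_specMap_fractionRing (A := A) K
  haveI := isPreimmersion_specMap_fractionRing (A := A) K
  -- the complement of the Cartier locus is constructible
  have hZc : Topology.IsConstructible (cartierLocus I)ᶜ :=
    ((NoetherianSpace.isCompact _).isConstructible (isOpen_cartierLocus I)).compl
  -- and its image misses the generic point
  have h0 : (⊥ : PrimeSpectrum A) ∉ q '' (cartierLocus I)ᶜ := by
    rintro ⟨z, hz, hzη⟩
    have hzr : z ∈ Set.range (pullback.fst q (specOfAlgebra A K)) := by
      rw [Scheme.Pullback.range_fst]
      change q z ∈ Set.range (Spec.map (CommRingCat.ofHom (algebraMap A K)))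
      rw [hzη]
      let y : Spec (CommRingCat.of K) := ⟨⊥, Ideal.isPrime_bot⟩
      exact ⟨y, specMap_fractionRing_apply K y⟩
    obtain ⟨z', rfl⟩ := hzr
    haveI : IsIso ((pullback.fst q (specOfAlgebra A K)).stalkMap z') :=
      isIso_stalkMap_of_flat_of_isPreimmersion _ z'
    exact hz ((mem_cartierLocus_comap_iff _ z' I).mp (hK.mem_cartierLocus z'))
  obtain ⟨b, hb0, hb⟩ := Literature.AlgebraicGeometry.Limits.exists_basicOpen_disjoint_image q hZc h0
  refine ⟨b, hb0, fun x hx => ?_⟩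
  by_contra hxs
  exact Set.disjoint_left.mp hb hx ⟨x, hxs, rfl⟩

/-- … so that **`I|_{q⁻¹ D(b)}` is an effective Cartier divisor for some `b ≠ 0`**.
[cite: StacksProject, Tag 01WS] -/
theorem exists_isEffectiveCartier_comap_ι_of_generic [QuasiCompact q] [IsNoetherian X]
    (I : X.IdealSheafData) (hK : IsEffectiveCartier (I.comap (pullback.fst q (specOfAlgebra A K)))) :
    ∃ b : A, b ≠ 0 ∧ IsEffectiveCartier (I.comap (q ⁻¹ᵁ (basicOpen b)).ι) := by
  obtain ⟨b, hb0, hb⟩ := exists_forall_mem_cartierLocus_of_generic K q I hK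
  exact ⟨b, hb0, isEffectiveCartier_comap_ι_of_forall_mem_cartierLocus fun x hx => hb x hx⟩

end Generic

end Literature.AlgebraicGeometry.Resolution

end
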